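import Summits.AnomalousDissipation.AnomalousDissipation.Theorems.SolenoidalFractalHomogenisationLagrangianStepSidebandDefs
import HarnessLib

/-!
# K1L_D `LagrangianRenormalisationStepDesign` (stmt-AnomalousDissipation-27980), `stub_D1_V0R` (ruling D27-1), brick T8b: THE EXPLICIT CONSTANTS of the
# residual energy inequality — `xiCN` (response size), `xiCf` (feedback size) and `energyConst` (the `C(W₁, lo, hi, β)` of
# `…SidebandXEnergy.residualX_energy_ineq`, written out) (shared definitions; reviewed; `--kind definition --supports stmt-AnomalousDissipation-27980 --as helper`)

Summits-side DEFINITIONS file of route `SolenoidalFractalHomogenisation` (prover seat `ad-k1l-cellLawV-w1` g7).  The assembly of `stub_D1_V0R` must track the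
`ν`-dependence of every constant (the window of clause (V) is `NearIso 𝔸 (ν lo/λ) (ν hi λ)`, so `lo ∼ ν`; cell STATUS 2026-08-29 w1 g7), which the
`∃ C` of `residualX_energy_ineq` hides; these are the constants of its proof, verbatim:
* `xiCf W₁ = Σⱼ 4π‖αⱼ‖`, `xiCN W₁ lo = Σⱼ 8π‖αⱼ‖/min(1, 4π²lo)`;
* `energyConst W₁ lo hi β = 32π²534²(hi+β/2)²/lo + 24CL²/(π²lo) + 6C₂²/(π²lo) + 12(xiCN·4π²(hi+β/2))²/(π²lo) + 12(xiCN·xiCf)²/(π²lo) + 2/lo`,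
  `CL = Σⱼ 2π‖αⱼ‖(5+3|mⱼ|)`, `C₂ = Σⱼ 4π‖αⱼ‖/|mⱼ|`.
Definitions + unfolding lemmas only; no theorem of substance, no named fact, no sorry.  NOT a proof of anything; rung F-D1.A0 infrastructure.
-/

set_option linter.dupNamespace false

noncomputable section

namespace Summit.AnomalousDissipation.AnomalousDissipation.Theorems.SolenoidalFractalHomogenisation.LagrangianStep.Sideband

open Literature.Analysis Literature.Analysis.FunctionSpaces Literature.Analysis.FunctionSpaces.Torus
open Literature.Analysis.FluidPDE Literature.Analysis.FluidPDE.Torus Literature.Analysis.FluidPDE.LatticeShear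

variable {k₀ : ℕ}

/-- **Feedback size** `C_f = Σⱼ 4π‖αⱼ‖`. [cite: MajdaKramer1999, §2.2.1.3 (55)] -/
def xiCf (W₁ : LatticeWord k₀) : ℝ := ∑ j, 4 * Real.pi * ‖slotAmp W₁ j‖

/-- Unfolding `xiCf`. [cite: MajdaKramer1999, §2.2.1.3 (55)] -/
theorem xiCf_def (W₁ : LatticeWord k₀) : xiCf W₁ = ∑ j, 4 * Real.pi * ‖slotAmp W₁ j‖ := rfl

/-- **Response size** `C_N(lo) = Σⱼ 8π‖αⱼ‖/min(1, 4π²lo)`. [cite: SandersVerhulstMurdock2007, Lemma 5.2.7 (linear case)] -/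
def xiCN (W₁ : LatticeWord k₀) (lo : ℝ) : ℝ := ∑ j, 8 * Real.pi * ‖slotAmp W₁ j‖ / min 1 (4 * Real.pi ^ 2 * lo)

/-- Unfolding `xiCN`. [cite: SandersVerhulstMurdock2007, Lemma 5.2.7 (linear case)] -/
theorem xiCN_def (W₁ : LatticeWord k₀) (lo : ℝ) : xiCN W₁ lo = ∑ j, 8 * Real.pi * ‖slotAmp W₁ j‖ / min 1 (4 * Real.pi ^ 2 * lo) := rfl

/-- **The constant of the residual energy inequality** (`…SidebandXEnergy.residualX_energy_ineq`, written out).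
[cite: MajdaKramer1999, §2.2.1.3 (cell problem (49))] -/
def energyConst (W₁ : LatticeWord k₀) (lo hi β : ℝ) : ℝ :=
  32 * Real.pi ^ 2 * 534 ^ 2 * (hi + β / 2) ^ 2 / lo +
    24 * (∑ j, 2 * Real.pi * ‖slotAmp W₁ j‖ * (5 + 3 * Real.sqrt (freqNormSq (W₁.phase j).m))) ^ 2 / (Real.pi ^ 2 * lo) +
    6 * (∑ j, 4 * Real.pi * ‖slotAmp W₁ j‖ / Real.sqrt (freqNormSq (W₁.phase j).m)) ^ 2 / (Real.pi ^ 2 * lo) +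
    12 * (xiCN W₁ lo * (4 * Real.pi ^ 2 * (hi + β / 2))) ^ 2 / (Real.pi ^ 2 * lo) +
    12 * (xiCN W₁ lo * xiCf W₁) ^ 2 / (Real.pi ^ 2 * lo) + 2 / lo

/-- Unfolding `energyConst`. [cite: MajdaKramer1999, §2.2.1.3 (cell problem (49))] -/
theorem energyConst_def (W₁ : LatticeWord k₀) (lo hi β : ℝ) : energyConst W₁ lo hi β =
    32 * Real.pi ^ 2 * 534 ^ 2 * (hi + β / 2) ^ 2 / lo +
      24 * (∑ j, 2 * Real.pi * ‖slotAmp W₁ j‖ * (5 + 3 * Real.sqrt (freqNormSq (W₁.phase j).m))) ^ 2 / (Real.pi ^ 2 * lo) +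
      6 * (∑ j, 4 * Real.pi * ‖slotAmp W₁ j‖ / Real.sqrt (freqNormSq (W₁.phase j).m)) ^ 2 / (Real.pi ^ 2 * lo) +
      12 * (xiCN W₁ lo * (4 * Real.pi ^ 2 * (hi + β / 2))) ^ 2 / (Real.pi ^ 2 * lo) +
      12 * (xiCN W₁ lo * xiCf W₁) ^ 2 / (Real.pi ^ 2 * lo) + 2 / lo := rfl

/-- `energyConst ≥ 0` for `lo > 0`. [folklore] -/
theorem energyConst_nonneg (W₁ : LatticeWord k₀) {lo : ℝ} (hlo : 0 < lo) (hi β : ℝ) : 0 ≤ energyConst W₁ lo hi β := by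
  unfold energyConst; positivity

/-- `xiCf ≥ 0`. [folklore] -/
theorem xiCf_nonneg (W₁ : LatticeWord k₀) : 0 ≤ xiCf W₁ := Finset.sum_nonneg fun j _ => by positivity

/-- `xiCN ≥ 0` for `lo > 0`. [folklore] -/
theorem xiCN_nonneg (W₁ : LatticeWord k₀) {lo : ℝ} (hlo : 0 < lo) : 0 ≤ xiCN W₁ lo := by
  have hmin : 0 < min 1 (4 * Real.pi ^ 2 * lo) := lt_min one_pos (by positivity)
  exact Finset.sum_nonneg fun j _ => by positivity

end Summit.AnomalousDissipation.AnomalousDissipation.Theorems.SolenoidalFractalHomogenisation.LagrangianStep.Sideband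

end
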